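import Mathlib
import Literature.NumberTheory.LFunctions.Zhang2022.Section2Lemma23Inputs
import HarnessLib

/-!
# Zhang (2022) §2, proof of Lemma 2.3 (pp. 11–12), II: the skeleton leaf `Ded23` DISCHARGED —
# Proposition 2.2 ⇒ Lemma 2.3 (`𝔠*(ρ,ψ) ≥ 0`), kernel-checked

Topic `Literature/NumberTheory/LFunctions/Zhang2022` (Landau–Siegel adjudication tree;
verdict-neutral). Y. Zhang, *Discrete mean estimates and the Landau–Siegel zero*,
arXiv:2211.02515v1 (2022) [Zhang2022LandauSiegel] — an unrefereed manuscript under adjudication.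
DAG node `Z22:Lem2.3.pf` [Z22 p.11, tex L667–L685] (with its steps `Z22:§2.u035`–`§2.u038` and the
Remark (2.34)); the printed proof is quoted in full in the companion `Section2Lemma23Inputs.lean`.
Objects: `ψ ∈ Ψ₁`, `ρ ∈ 𝔷(ψ)` (2.14), `M = Y·L(·,ψ)` with `Y² = Z(·,ψ)⁻¹` (§2 p. 5),
`β₁ = iα(1−5c′α𝓛)`, `β₂ = 2iα(1+c′α𝓛)`, `β₃ = 3iα(1−c′α𝓛)` (2.13),
`𝔠*(ρ,ψ) = −iM(ρ+β₁)M(ρ+β₂)M(ρ+β₃)/M′(ρ)`.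

The typed skeleton records this deduction as the CLAIM node `Skeleton.Ded23 c′ := Prop22 c′ →
Lemma23 c′` (`SkeletonPartOne.lean`), the leaf `hD23` of the whole-DAG theorem
`Skeleton.theorem1_of_leaves` (which takes `0 ≤ c′`). This file PROVES it, for every `c′ ≥ 0`:

* `Skeleton.M_signs_of_prop22_at` — the two sign statements of the proof ("`M(ρ+β₂)M(ρ+β₃) > 0`",
  `Z22:§2.u035`; "`M(ρ+β₁)/(iM′(ρ)) ≥ 0`", `Z22:§2.u038`, in fact `> 0`) at one `ρ ∈ 𝔷(ψ)` from
  Proposition 2.2 (i)–(iii) at one `ψ`, for `D ≥ 3`, `5c′α𝓛 < 1`, `α ≤ 1/2`;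
* `Skeleton.cstar_eq_mul`, `Skeleton.cstar_nonneg_of_prop22_at` — `𝔠* = [M(ρ+β₁)/(iM′(ρ))]·
  [M(ρ+β₂)M(ρ+β₃)]`, hence real and `≥ 0`; `Skeleton.eq234_of_prop22_at` — the Remark (2.34)
  "`|L(ρ+β₁,ψ)/L′(ρ,ψ)| = −iM(ρ+β₁,ψ)/M′(ρ,ψ)`" at one `ρ`;
* `Skeleton.forAllLarge_of_prop22` (with `alpha_small_of_le`: `𝓛 ≥ max(2, 5πc′+1)` gives
  `5c′α𝓛 < 1`, `α ≤ 1/2`) — "for `D` sufficiently large" from Proposition 2.2;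
* `Skeleton.ded23_holds : 0 ≤ c′ → Ded23 c′` (the typed steps `§2.u035`–`§2.u038`, (2.34) follow
  from the `_at` theorems the same way, in the file that imports their typed statements).

The proof is the manuscript's, made exact (ingredients in `Section2Lemma23Inputs.lean`). From
Proposition 2.2 (i) and the restated (iii), with the finiteness of the `Ω`-zeros, `L(½+iu,ψ) ≠ 0`
for `γ < u ≤ γ+|β₁|` and for `γ+|β₂| ≤ u ≤ γ+|β₃|` once `5c′α𝓛 < 1`; the real continuous function
`u ↦ M(½+iu,ψ)` ((2.11)) therefore keeps its sign on each range (intermediate value theorem — the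
print says "mean-value theorem"); at `u = γ` it vanishes with the non-zero real derivative
`iM′(ρ,ψ)` ((2.12) and Proposition 2.2 (ii)), so `M(ρ+β₁)·(iM′(ρ)) > 0` (the printed limit,
done with the right-hand slope); and `𝔠* = M(ρ+β₁)M(ρ+β₂)M(ρ+β₃)/(iM′(ρ))` is a non-negative
(indeed positive) real. "`D` sufficiently large" costs `𝓛 ≥ max(2, 5πc′+1)` (so that
`α = π/𝓛⁹ ≤ 1/2` and `5c′α𝓛 = 5πc′/𝓛⁸ < 1`).

No new definitions, no named facts, no hypotheses beyond `Prop22 c′`; nothing here bears on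
Theorems 1–2 of the source or on the cell's verdict on (8.24). Cell siegel-zhang (D-0069),
discharge row D20 / cone C11.

## References

* Y. Zhang, arXiv:2211.02515v1 (2022), §2: Proposition 2.2 and its restatement (2.13) p. 7,
  (2.11)–(2.12), (2.14), Lemma 2.3 p. 8, proof of Lemma 2.3 pp. 11–12 (tex L667–L685).
  [cite: Zhang2022LandauSiegel, §2 Lemma 2.3 (proof) pp. 11–12]
-/

noncomputable section

open Complex Real Filter Topology Set

namespace Literature.NumberTheory.LFunctions.Zhang2022.Skeleton

section Setting

variable {D : ℕ} [NeZero D] (χ : DirichletCharacter ℂ D)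


omit [NeZero D] in
/-- For a point `ρ` on the critical line, `ρ + β₁ = ½ + i(γ + α(1 − 5c′α𝓛))` (2.13).
[cite: Zhang2022LandauSiegel, §2 (2.13)] -/
theorem add_beta1_eq {c' : ℝ} {ρ : ℂ} (hre : ρ.re = 1 / 2) :
    ρ + beta1 c' D = (1 : ℂ) / 2 + ((ρ.im + alpha D * (1 - 5 * c' * alpha D * ell D) : ℝ) : ℂ) * I := by
  have hρeq : ρ = (1 : ℂ) / 2 + (ρ.im : ℂ) * I := Complex.ext (by simp [hre]) (by simp)
  rw [hρeq, beta1]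
  apply Complex.ext <;> simp

omit [NeZero D] in
/-- For a point `ρ` on the critical line, `ρ + β₂ = ½ + i(γ + 2α(1 + c′α𝓛))` (2.13).
[cite: Zhang2022LandauSiegel, §2 (2.13)] -/
theorem add_beta2_eq {c' : ℝ} {ρ : ℂ} (hre : ρ.re = 1 / 2) :
    ρ + beta2 c' D = (1 : ℂ) / 2 + ((ρ.im + 2 * alpha D * (1 + c' * alpha D * ell D) : ℝ) : ℂ) * I := by
  have hρeq : ρ = (1 : ℂ) / 2 + (ρ.im : ℂ) * I := Complex.ext (by simp [hre]) (by simp)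
  rw [hρeq, beta2]
  apply Complex.ext <;> simp

omit [NeZero D] in
/-- For a point `ρ` on the critical line, `ρ + β₃ = ½ + i(γ + 3α(1 − c′α𝓛))` (2.13).
[cite: Zhang2022LandauSiegel, §2 (2.13)] -/
theorem add_beta3_eq {c' : ℝ} {ρ : ℂ} (hre : ρ.re = 1 / 2) :
    ρ + beta3 c' D = (1 : ℂ) / 2 + ((ρ.im + 3 * alpha D * (1 - c' * alpha D * ell D) : ℝ) : ℂ) * I := by
  have hρeq : ρ = (1 : ℂ) / 2 + (ρ.im : ℂ) * I := Complex.ext (by simp [hre]) (by simp)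
  rw [hρeq, beta3]
  apply Complex.ext <;> simp

/-- **"`M(ρ+iv,ψ) ≠ 0` if `0 < v ≤ |β₁|`" and "… if `|β₂| ≤ v ≤ |β₃|`"** (p. 11) for the
skeleton's `M`, at one zero, from Proposition 2.2 (i), (iii) at one character: for `D ≥ 3`, `χ`
primitive, `c′ ≥ 0` with `5c′α𝓛 < 1`, `α ≤ 1/2`, and `ρ = ½+iγ ∈ 𝔷(ψ)`: `M(½+iu,ψ) ≠ 0` for
`γ < u ≤ γ + α(1−5c′α𝓛)` and for `γ + 2α(1+c′α𝓛) ≤ u ≤ γ + 3α(1−c′α𝓛)` (`Z22:§2.u035a`).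
[cite: Zhang2022LandauSiegel, §2 proof of Lemma 2.3 p. 11] -/
theorem Mfun_half_ne_zero_of_prop22_at (hD : 3 ≤ D) (hχ : χ.IsPrimitive) {c' : ℝ} (hc' : 0 ≤ c')
    (hsmall : 5 * c' * alpha D * ell D < 1) (hαhalf : alpha D ≤ 1 / 2) (x : Chr D)
    (h_iii : ∀ s ∈ prodZeroSetOmega χ x, ∀ s' ∈ prodZeroSetOmega χ x, s.im < s'.im →
      (∀ s'' ∈ prodZeroSetOmega χ x, ¬ (s.im < s''.im ∧ s''.im < s'.im)) →
        |s'.im - s.im - alpha D| < c' * alpha D ^ 2 * ell D)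
    {ρ : ℂ} (hρ : ρ ∈ zeroSet D x) {u : ℝ}
    (hu : (ρ.im < u ∧ u ≤ ρ.im + alpha D * (1 - 5 * c' * alpha D * ell D)) ∨
      (ρ.im + 2 * alpha D * (1 + c' * alpha D * ell D) ≤ u ∧
        u ≤ ρ.im + 3 * alpha D * (1 - c' * alpha D * ell D))) :
    Mfun x.ψ ((1 : ℂ) / 2 + u * I) ≠ 0 := by
  have hρS : ρ ∈ prodZeroSetOmega χ x := mem_prodZeroSetOmega_of_mem_zeroSet χ hρ
  have hγ : 0 < ρ.im := im_pos_of_mem_zeroSet hD hρ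
  have hℓ : 1 < ell D := one_lt_ell hD
  have hα : 0 < alpha D := by
    rw [alpha, bigP, Real.log_exp]; exact div_pos Real.pi_pos (pow_pos (by linarith) _)
  have he : 0 ≤ c' * alpha D ^ 2 * ell D := by positivity
  have h5e : 5 * (c' * alpha D ^ 2 * ell D) < alpha D := by
    have : 5 * (c' * alpha D ^ 2 * ell D) = alpha D * (5 * c' * alpha D * ell D) := by ring
    rw [this]; nlinarith
  have hv₁ : alpha D * (1 - 5 * c' * alpha D * ell D) = alpha D - 5 * (c' * alpha D ^ 2 * ell D) := by
    ring
  have hv₂ : 2 * alpha D * (1 + c' * alpha D * ell D)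
      = 2 * alpha D + 2 * (c' * alpha D ^ 2 * ell D) := by ring
  have hv₃ : 3 * alpha D * (1 - c' * alpha D * ell D)
      = 3 * alpha D - 3 * (c' * alpha D ^ 2 * ell D) := by ring
  rw [hv₁, hv₂, hv₃] at hu
  have hu0 : ρ.im < u := by rcases hu with ⟨h, -⟩ | ⟨h, -⟩ <;> linarith
  have hu2 : u < ρ.im + 2 := by rcases hu with ⟨-, h⟩ | ⟨-, h⟩ <;> linarith
  have hL : x.ψ.LFunction ((1 : ℂ) / 2 + u * I) ≠ 0 := by
    refine LFunction_half_ne_zero_of_gap χ (prodZeroSetOmega_finite χ hD hχ x) (by linarith) h_iii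
      hρS (half_add_mem_Omega hρ hu0.le hu2) ?_
    rcases hu with ⟨h1, h2⟩ | ⟨h1, h2⟩
    · left; exact ⟨h1, by linarith⟩
    · right; exact ⟨by linarith, by linarith⟩
  exact Mfun_ne_zero x (by simpa using lt_trans hγ hu0) hL

/-- **The two sign statements of the proof of Lemma 2.3, at one zero, from Proposition 2.2 at one
character** (pp. 11–12: "`M(ρ+β₂,ψ)M(ρ+β₃,ψ) > 0`" (`Z22:§2.u035`) and
"`M(ρ+β₁,ψ)/(iM′(ρ,ψ)) ≥ 0`" (`Z22:§2.u038`, here with `>`)): for `D ≥ 3`, `χ` primitive,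
`c′ ≥ 0` with `5c′α𝓛 < 1` and `α ≤ 1/2`, if the zeros of `L(s,ψ)L(s,ψχ)` in `Ω` lie on the critical
line (i), are simple (ii) and have consecutive gaps `α ± c′α²𝓛` (iii restated), then for every
`ρ ∈ 𝔷(ψ)` both `M(ρ+β₁,ψ)/(iM′(ρ,ψ))` and `M(ρ+β₂,ψ)M(ρ+β₃,ψ)` are positive reals.
[cite: Zhang2022LandauSiegel, §2 proof of Lemma 2.3 pp. 11–12] -/
theorem M_signs_of_prop22_at (hD : 3 ≤ D) (hχ : χ.IsPrimitive) {c' : ℝ} (hc' : 0 ≤ c')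
    (hsmall : 5 * c' * alpha D * ell D < 1) (hαhalf : alpha D ≤ 1 / 2) (x : Chr D)
    (h_i : ∀ s ∈ prodZeroSetOmega χ x, s.re = 1 / 2)
    (h_ii : ∀ s ∈ prodZeroSetOmega χ x,
      deriv (fun w => x.ψ.LFunction w * (psiChi χ x).LFunction w) s ≠ 0)
    (h_iii : ∀ s ∈ prodZeroSetOmega χ x, ∀ s' ∈ prodZeroSetOmega χ x, s.im < s'.im →
      (∀ s'' ∈ prodZeroSetOmega χ x, ¬ (s.im < s''.im ∧ s''.im < s'.im)) →
        |s'.im - s.im - alpha D| < c' * alpha D ^ 2 * ell D)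
    {ρ : ℂ} (hρ : ρ ∈ zeroSet D x) :
    ((Mfun x.ψ (ρ + beta1 c' D) / (I * deriv (Mfun x.ψ) ρ)).im = 0 ∧
      0 < (Mfun x.ψ (ρ + beta1 c' D) / (I * deriv (Mfun x.ψ) ρ)).re) ∧
    ((Mfun x.ψ (ρ + beta2 c' D) * Mfun x.ψ (ρ + beta3 c' D)).im = 0 ∧
      0 < (Mfun x.ψ (ρ + beta2 c' D) * Mfun x.ψ (ρ + beta3 c' D)).re) := by
  -- the data at `ρ`
  have hρS : ρ ∈ prodZeroSetOmega χ x := mem_prodZeroSetOmega_of_mem_zeroSet χ hρ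
  have hγ : 0 < ρ.im := im_pos_of_mem_zeroSet hD hρ
  have hre : ρ.re = 1 / 2 := h_i ρ hρS
  have hρeq : ρ = (1 : ℂ) / 2 + (ρ.im : ℂ) * I := Complex.ext (by simp [hre]) (by simp)
  have hL0 : x.ψ.LFunction ρ = 0 := hρ.2.2
  -- the parameters
  have hℓ : 1 < ell D := one_lt_ell hD
  have hα : 0 < alpha D := by
    rw [alpha, bigP, Real.log_exp]; exact div_pos Real.pi_pos (pow_pos (by linarith) _)
  set e : ℝ := c' * alpha D ^ 2 * ell D with he_def
  have he : 0 ≤ e := by positivity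
  have h5e : 5 * e < alpha D := by
    have : 5 * e = alpha D * (5 * c' * alpha D * ell D) := by rw [he_def]; ring
    rw [this]; nlinarith
  -- the heights `v_j = |β_j|`
  set v₁ : ℝ := alpha D * (1 - 5 * c' * alpha D * ell D) with hv₁_def
  set v₂ : ℝ := 2 * alpha D * (1 + c' * alpha D * ell D) with hv₂_def
  set v₃ : ℝ := 3 * alpha D * (1 - c' * alpha D * ell D) with hv₃_def
  have hv₁ : v₁ = alpha D - 5 * e := by rw [hv₁_def, he_def]; ring
  have hv₂ : v₂ = 2 * alpha D + 2 * e := by rw [hv₂_def, he_def]; ring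
  have hv₃ : v₃ = 3 * alpha D - 3 * e := by rw [hv₃_def, he_def]; ring
  have hv₁pos : 0 < v₁ := by rw [hv₁]; linarith
  have hv₂₃ : v₂ ≤ v₃ := by rw [hv₂, hv₃]; linarith
  have hv₃lt : v₃ < 2 := by rw [hv₃]; linarith
  have hv₂pos : 0 < v₂ := by rw [hv₂]; linarith
  have hβ₁ : ρ + beta1 c' D = (1 : ℂ) / 2 + ((ρ.im + v₁ : ℝ) : ℂ) * I := add_beta1_eq hre
  have hβ₂ : ρ + beta2 c' D = (1 : ℂ) / 2 + ((ρ.im + v₂ : ℝ) : ℂ) * I := add_beta2_eq hre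
  have hβ₃ : ρ + beta3 c' D = (1 : ℂ) / 2 + ((ρ.im + v₃ : ℝ) : ℂ) * I := add_beta3_eq hre
  -- the real function `m(u) = M(½+iu,ψ)` and its zeros
  set m : ℝ → ℝ := fun u => (Mfun x.ψ ((1 : ℂ) / 2 + u * I)).re with hm_def
  have hm0 : m ρ.im = 0 := by
    simp only [hm_def]
    rw [← hρeq, show Mfun x.ψ ρ = Yroot x.ψ ρ * x.ψ.LFunction ρ from rfl, hL0, mul_zero,
      Complex.zero_re]
  have hmne : ∀ u : ℝ, ((ρ.im < u ∧ u ≤ ρ.im + v₁) ∨ (ρ.im + v₂ ≤ u ∧ u ≤ ρ.im + v₃)) → m u ≠ 0 := by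
    intro u hu hmu
    have hupos : 0 < u := by rcases hu with ⟨h, -⟩ | ⟨h, -⟩ <;> linarith
    apply Mfun_half_ne_zero_of_prop22_at χ hD hχ hc' hsmall hαhalf x h_iii hρ hu
    rw [Mfun_half_eq_ofReal x hupos]
    simp only [hm_def] at hmu
    rw [hmu, Complex.ofReal_zero]
  -- the derivative at `γ = Im ρ`: `m′(γ) = r = iM′(ρ)` real and non-zero
  obtain ⟨hderiv, hIim⟩ := hasDerivAt_Mfun_half_re x hγ
  rw [← hρeq] at hderiv hIim
  set d : ℂ := deriv (Mfun x.ψ) ρ with hd_def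
  set r : ℝ := (I * d).re with hr_def
  have hId : I * d = (r : ℂ) := Complex.ext (by simp [hr_def]) (by rw [hIim, Complex.ofReal_im])
  have hd0 : d ≠ 0 := by
    have hL1 := deriv_LFunction_ne_zero_of_deriv_LL_ne_zero χ hD hχ x hL0 (h_ii ρ hρS)
    exact GammaFactor.deriv_M_ne_zero_of_simple_zero x.prim x.p_ne_one (Yroot_spec x.prim).1
      (Yroot_spec x.prim).2 hγ hL0 hL1
  have hr0 : r ≠ 0 := by
    intro h
    rw [h, Complex.ofReal_zero] at hId
    exact (mul_ne_zero I_ne_zero hd0) hId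
  -- **"`M(ρ+β₁,ψ)/(iM′(ρ,ψ)) ≥ 0`"**: `r · m(γ + v₁) > 0`
  have hsign₁ : 0 < r * m (ρ.im + v₁) :=
    mul_pos_of_hasDerivAt_of_ne_zero (by linarith) (continuousOn_Mfun_half_re x hγ)
      (fun u hu => hmne u (Or.inl ⟨hu.1, hu.2⟩)) hm0 hderiv hr0
  -- **"`M(ρ+β₂,ψ)M(ρ+β₃,ψ) > 0`"**
  have hsign₂₃ : 0 < m (ρ.im + v₂) * m (ρ.im + v₃) :=
    mul_pos_of_continuousOn_of_ne_zero (by linarith) (continuousOn_Mfun_half_re x (by linarith))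
      (fun u hu => hmne u (Or.inr ⟨hu.1, hu.2⟩))
  -- the values as real numbers
  have hM₁ : Mfun x.ψ (ρ + beta1 c' D) = ((m (ρ.im + v₁) : ℝ) : ℂ) := by
    rw [hβ₁]; exact Mfun_half_eq_ofReal x (by linarith)
  have hM₂ : Mfun x.ψ (ρ + beta2 c' D) = ((m (ρ.im + v₂) : ℝ) : ℂ) := by
    rw [hβ₂]; exact Mfun_half_eq_ofReal x (by linarith)
  have hM₃ : Mfun x.ψ (ρ + beta3 c' D) = ((m (ρ.im + v₃) : ℝ) : ℂ) := by
    rw [hβ₃]; exact Mfun_half_eq_ofReal x (by linarith)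
  have hq : Mfun x.ψ (ρ + beta1 c' D) / (I * deriv (Mfun x.ψ) ρ)
      = ((m (ρ.im + v₁) / r : ℝ) : ℂ) := by
    rw [hM₁, ← hd_def, hId]; push_cast; ring
  have hw : Mfun x.ψ (ρ + beta2 c' D) * Mfun x.ψ (ρ + beta3 c' D)
      = ((m (ρ.im + v₂) * m (ρ.im + v₃) : ℝ) : ℂ) := by
    rw [hM₂, hM₃]; push_cast; ring
  have hqpos : 0 < m (ρ.im + v₁) / r := by
    have : m (ρ.im + v₁) / r = r * m (ρ.im + v₁) / (r * r) := by field_simp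
    rw [this]
    exact div_pos hsign₁ (mul_self_pos.mpr hr0)
  rw [hq, hw, Complex.ofReal_im, Complex.ofReal_re, Complex.ofReal_im, Complex.ofReal_re]
  exact ⟨⟨rfl, hqpos⟩, rfl, hsign₂₃⟩

omit [NeZero D] in
/-- `𝔠*(ρ,ψ) = [M(ρ+β₁)/(iM′(ρ))]·[M(ρ+β₂)M(ρ+β₃)]` (`−i/M′ = 1/(iM′)`; also when `M′(ρ) = 0`, both
sides being `0`). [cite: Zhang2022LandauSiegel, §2 p. 5 (after (2.14))] -/
theorem cstar_eq_mul (c' : ℝ) (x : Chr D) (ρ : ℂ) :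
    cstar c' D x ρ = Mfun x.ψ (ρ + beta1 c' D) / (I * deriv (Mfun x.ψ) ρ) *
      (Mfun x.ψ (ρ + beta2 c' D) * Mfun x.ψ (ρ + beta3 c' D)) := by
  rw [cstar]
  rcases eq_or_ne (deriv (Mfun x.ψ) ρ) 0 with h0 | h0
  · rw [h0]; simp
  · rw [div_mul_eq_mul_div, div_eq_div_iff h0 (mul_ne_zero I_ne_zero h0)]
    linear_combination (-(Mfun x.ψ (ρ + beta1 c' D) * Mfun x.ψ (ρ + beta2 c' D) *
      Mfun x.ψ (ρ + beta3 c' D) * deriv (Mfun x.ψ) ρ)) * I_sq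

/-- **Lemma 2.3 at one zero, from Proposition 2.2 at one character** (pp. 11–12): under the
hypotheses of `M_signs_of_prop22_at`, for every `ρ ∈ 𝔷(ψ)`: `𝔠*(ρ,ψ)` is real and `𝔠*(ρ,ψ) ≥ 0`
("This completes the proof"). [cite: Zhang2022LandauSiegel, §2 proof of Lemma 2.3 pp. 11–12] -/
theorem cstar_nonneg_of_prop22_at (hD : 3 ≤ D) (hχ : χ.IsPrimitive) {c' : ℝ} (hc' : 0 ≤ c')
    (hsmall : 5 * c' * alpha D * ell D < 1) (hαhalf : alpha D ≤ 1 / 2) (x : Chr D)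
    (h_i : ∀ s ∈ prodZeroSetOmega χ x, s.re = 1 / 2)
    (h_ii : ∀ s ∈ prodZeroSetOmega χ x,
      deriv (fun w => x.ψ.LFunction w * (psiChi χ x).LFunction w) s ≠ 0)
    (h_iii : ∀ s ∈ prodZeroSetOmega χ x, ∀ s' ∈ prodZeroSetOmega χ x, s.im < s'.im →
      (∀ s'' ∈ prodZeroSetOmega χ x, ¬ (s.im < s''.im ∧ s''.im < s'.im)) →
        |s'.im - s.im - alpha D| < c' * alpha D ^ 2 * ell D)
    {ρ : ℂ} (hρ : ρ ∈ zeroSet D x) :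
    (cstar c' D x ρ).im = 0 ∧ 0 ≤ (cstar c' D x ρ).re := by
  obtain ⟨⟨hqi, hqr⟩, hwi, hwr⟩ :=
    M_signs_of_prop22_at χ hD hχ hc' hsmall hαhalf x h_i h_ii h_iii hρ
  rw [cstar_eq_mul]
  generalize Mfun x.ψ (ρ + beta1 c' D) / (I * deriv (Mfun x.ψ) ρ) = q at hqi hqr ⊢
  generalize Mfun x.ψ (ρ + beta2 c' D) * Mfun x.ψ (ρ + beta3 c' D) = w at hwi hwr ⊢
  rw [Complex.mul_im, Complex.mul_re, hqi, hwi, mul_zero, zero_mul, add_zero, mul_zero, sub_zero]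
  exact ⟨rfl, (mul_pos hqr hwr).le⟩

/-- **The Remark (2.34), at one zero** (p. 12: "It is implied in the proof of Lemma 2.3 that
`|L(ρ+β₁,ψ)/L′(ρ,ψ)| = −iM(ρ+β₁,ψ)/M′(ρ,ψ)`"): under the hypotheses of `M_signs_of_prop22_at`
the right side is the positive real `M(ρ+β₁)/(iM′(ρ))`, whose modulus is `|L(ρ+β₁,ψ)|/|L′(ρ,ψ)|`
because `|Y(½+it,ψ)| = 1` and `M′(ρ,ψ) = Y(ρ,ψ)L′(ρ,ψ)`. [cite: Zhang2022LandauSiegel, §2 (2.34) p. 12] -/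
theorem eq234_of_prop22_at (hD : 3 ≤ D) (hχ : χ.IsPrimitive) {c' : ℝ} (hc' : 0 ≤ c')
    (hsmall : 5 * c' * alpha D * ell D < 1) (hαhalf : alpha D ≤ 1 / 2) (x : Chr D)
    (h_i : ∀ s ∈ prodZeroSetOmega χ x, s.re = 1 / 2)
    (h_ii : ∀ s ∈ prodZeroSetOmega χ x,
      deriv (fun w => x.ψ.LFunction w * (psiChi χ x).LFunction w) s ≠ 0)
    (h_iii : ∀ s ∈ prodZeroSetOmega χ x, ∀ s' ∈ prodZeroSetOmega χ x, s.im < s'.im →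
      (∀ s'' ∈ prodZeroSetOmega χ x, ¬ (s.im < s''.im ∧ s''.im < s'.im)) →
        |s'.im - s.im - alpha D| < c' * alpha D ^ 2 * ell D)
    {ρ : ℂ} (hρ : ρ ∈ zeroSet D x) :
    ((‖x.ψ.LFunction (ρ + beta1 c' D) / deriv x.ψ.LFunction ρ‖ : ℝ) : ℂ)
      = -I * Mfun x.ψ (ρ + beta1 c' D) / deriv (Mfun x.ψ) ρ := by
  obtain ⟨⟨hqi, hqr⟩, -, -⟩ :=
    M_signs_of_prop22_at χ hD hχ hc' hsmall hαhalf x h_i h_ii h_iii hρ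
  have hρS : ρ ∈ prodZeroSetOmega χ x := mem_prodZeroSetOmega_of_mem_zeroSet χ hρ
  have hγ : 0 < ρ.im := im_pos_of_mem_zeroSet hD hρ
  have hre : ρ.re = 1 / 2 := h_i ρ hρS
  have hL0 : x.ψ.LFunction ρ = 0 := hρ.2.2
  have hα : 0 < alpha D := by
    rw [alpha, bigP, Real.log_exp]
    exact div_pos Real.pi_pos (pow_pos (by linarith [one_lt_ell hD]) _)
  have hv₁ : 0 < ρ.im + alpha D * (1 - 5 * c' * alpha D * ell D) := by
    have : 0 < alpha D * (1 - 5 * c' * alpha D * ell D) := mul_pos hα (by linarith)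
    linarith
  set q : ℂ := Mfun x.ψ (ρ + beta1 c' D) / (I * deriv (Mfun x.ψ) ρ) with hq_def
  -- `−iM(ρ+β₁)/M′(ρ) = M(ρ+β₁)/(iM′(ρ)) = q`
  have hrhs : -I * Mfun x.ψ (ρ + beta1 c' D) / deriv (Mfun x.ψ) ρ = q := by
    rw [hq_def]
    rcases eq_or_ne (deriv (Mfun x.ψ) ρ) 0 with h0 | h0
    · rw [h0]; simp
    · rw [div_eq_div_iff h0 (mul_ne_zero I_ne_zero h0)]
      linear_combination (-(Mfun x.ψ (ρ + beta1 c' D) * deriv (Mfun x.ψ) ρ)) * I_sq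
  -- `|Y(ρ+β₁)| = 1`, `M′(ρ) = Y(ρ)L′(ρ)`, `|Y(ρ)| = 1`
  have hY₁ : ‖Yroot x.ψ (ρ + beta1 c' D)‖ = 1 := by
    rw [add_beta1_eq hre]
    exact GammaFactor.norm_sqrt_inv_Zfac_half_eq_one x.prim (Yroot_spec x.prim).2 hv₁
  have hYρ : ‖Yroot x.ψ ρ‖ = 1 := by
    have hρeq : ρ = (1 : ℂ) / 2 + (ρ.im : ℂ) * I := Complex.ext (by simp [hre]) (by simp)
    rw [hρeq]
    exact GammaFactor.norm_sqrt_inv_Zfac_half_eq_one x.prim (Yroot_spec x.prim).2 hγ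
  have hd : deriv (Mfun x.ψ) ρ = Yroot x.ψ ρ * deriv x.ψ.LFunction ρ :=
    GammaFactor.deriv_M_eq_of_LFunction_eq_zero x.ψ_ne_one (Yroot_spec x.prim).1 hγ hL0
  have hnorm : ‖q‖ = ‖x.ψ.LFunction (ρ + beta1 c' D) / deriv x.ψ.LFunction ρ‖ := by
    rw [hq_def, hd, show Mfun x.ψ (ρ + beta1 c' D)
      = Yroot x.ψ (ρ + beta1 c' D) * x.ψ.LFunction (ρ + beta1 c' D) from rfl]
    simp only [norm_div, norm_mul, Complex.norm_I, hY₁, hYρ, one_mul]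
  -- `q` is a positive real, hence equal to its modulus
  have hqre : q = ((q.re : ℝ) : ℂ) := Complex.ext (by simp) (by simp [hqi])
  have hqn : ‖q‖ = q.re := by
    rw [hqre, Complex.norm_real, Real.norm_of_nonneg hqr.le, Complex.ofReal_re]
  rw [hrhs, ← hnorm, hqn, ← hqre]

end Setting

/-! ## "For `D` sufficiently large": Proposition 2.2 delivers the hypotheses above -/

/-- `L₀ ≤ log D` once `D ≥ ⌈exp L₀⌉₊`. [folklore] -/
private theorem ded23_threshold_le_ell {L₀ : ℝ} {D : ℕ} (hD : ⌈Real.exp L₀⌉₊ ≤ D) :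
    L₀ ≤ ell D := by
  have h : Real.exp L₀ ≤ D := le_trans (Nat.le_ceil _) (by exact_mod_cast hD)
  exact (Real.le_log_iff_exp_le (lt_of_lt_of_le (Real.exp_pos _) h)).mpr h

/-- The thresholds: for `𝓛 ≥ max(2, 5πc′+1)` one has `5c′α𝓛 < 1` and `α ≤ 1/2`
(`α = π/𝓛⁹`, (2.6), (2.10)). [cite: Zhang2022LandauSiegel, §2 (2.10)] -/
theorem alpha_small_of_le {c' : ℝ} {D : ℕ} (hD : ⌈Real.exp (max 2 (5 * π * c' + 1))⌉₊ ≤ D) :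
    5 * c' * alpha D * ell D < 1 ∧ alpha D ≤ 1 / 2 := by
  have hL := ded23_threshold_le_ell hD
  have hℓ2 : 2 ≤ ell D := le_trans (le_max_left _ _) hL
  have hℓc : 5 * π * c' + 1 ≤ ell D := le_trans (le_max_right _ _) hL
  have hα : alpha D = π / ell D ^ 9 := by rw [alpha, bigP, Real.log_exp]
  have hℓ9 : (512 : ℝ) ≤ ell D ^ 9 := by
    calc (512 : ℝ) = 2 ^ 9 := by norm_num
      _ ≤ ell D ^ 9 := by gcongr
  refine ⟨?_, ?_⟩
  · have h8 : ell D ≤ ell D ^ 8 := le_self_pow₀ (by linarith) (by norm_num)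
    have hkey : 5 * c' * π * ell D < ell D ^ 9 := by
      have h9 : ell D ^ 9 = ell D ^ 8 * ell D := by ring
      rw [h9]
      have : 5 * π * c' < ell D ^ 8 := by linarith
      nlinarith
    rw [hα]
    calc 5 * c' * (π / ell D ^ 9) * ell D = 5 * c' * π * ell D / ell D ^ 9 := by ring
      _ < 1 := by rw [div_lt_one (by positivity)]; exact hkey
  · rw [hα, div_le_iff₀ (by positivity)]
    nlinarith [Real.pi_lt_four]

/-- **"`D` greater than a sufficiently large number" for the proof of Lemma 2.3**: from
Proposition 2.2 (with constant `c′`), every statement `S D χ` that follows — for `D ≥ 3`,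
`χ` primitive, `5c′α𝓛 < 1`, `α ≤ 1/2` — from (i), (ii), (iii) at each `ψ ∈ Ψ₁`, holds for all
large `D`. [cite: Zhang2022LandauSiegel, §2 p. 4, proof of Lemma 2.3 pp. 11–12] -/
theorem forAllLarge_of_prop22 {c' : ℝ} (h22 : Prop22 c')
    {S : (D : ℕ) → [NeZero D] → DirichletCharacter ℂ D → Prop}
    (hS : ∀ (D : ℕ) [NeZero D] (χ : DirichletCharacter ℂ D), 3 ≤ D → χ.IsPrimitive →
      5 * c' * alpha D * ell D < 1 → alpha D ≤ 1 / 2 →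
      (∀ x ∈ PsiOne χ,
        (∀ s ∈ prodZeroSetOmega χ x, s.re = 1 / 2) ∧
        (∀ s ∈ prodZeroSetOmega χ x,
          deriv (fun w => x.ψ.LFunction w * (psiChi χ x).LFunction w) s ≠ 0) ∧
        (∀ s ∈ prodZeroSetOmega χ x, ∀ s' ∈ prodZeroSetOmega χ x, s.im < s'.im →
          (∀ s'' ∈ prodZeroSetOmega χ x, ¬ (s.im < s''.im ∧ s''.im < s'.im)) →
            |s'.im - s.im - alpha D| < c' * alpha D ^ 2 * ell D)) →
      S D χ) :
    ForAllLarge S := by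
  obtain ⟨h_i, h_ii, h_iii⟩ := h22
  obtain ⟨D₁, h⟩ := (h_i.and h_ii).and h_iii
  refine ⟨max (max D₁ 3) ⌈Real.exp (max 2 (5 * π * c' + 1))⌉₊, fun D _ χ hD hq hp => ?_⟩
  have hD₁ : D₁ ≤ D := le_trans (le_trans (le_max_left _ _) (le_max_left _ _)) hD
  have hD3 : 3 ≤ D := le_trans (le_trans (le_max_right _ _) (le_max_left _ _)) hD
  obtain ⟨hsmall, hαhalf⟩ := alpha_small_of_le (le_trans (le_max_right _ _) hD)
  obtain ⟨⟨h1, h2⟩, h3⟩ := h D χ hD₁ hq hp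
  exact hS D χ hD3 hp hsmall hαhalf fun x hx => ⟨h1 x hx, h2 x hx, h3 x hx⟩

/-! ## The leaf `Ded23` discharged -/

/-- **The skeleton leaf `Ded23` HOLDS: Proposition 2.2 ⇒ Lemma 2.3**, for every constant `c′ ≥ 0`
of (2.13) — the manuscript's proof of Lemma 2.3 (§2 pp. 11–12, DAG node `Z22:Lem2.3.pf`),
kernel-checked: for `D` large (`𝓛 ≥ max(2, 5πc′ + 1)`), every real primitive `χ (mod D)`, every
`ψ ∈ Ψ₁` and every `ρ ∈ 𝔷(ψ)`, Proposition 2.2 (i)–(iii) for `ψ` give `𝔠*(ρ,ψ) ∈ ℝ` and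
`𝔠*(ρ,ψ) ≥ 0` (`cstar_nonneg_of_prop22_at`). This discharges the hypothesis `hD23` of
`Skeleton.theorem1_of_leaves`. [cite: Zhang2022LandauSiegel, §2 Lemma 2.3 (proof) pp. 11–12] -/
theorem ded23_holds {c' : ℝ} (hc' : 0 ≤ c') : Ded23 c' := fun h22 =>
  forAllLarge_of_prop22 h22 fun _ _ χ hD hp hsmall hαhalf h x hx _ hρ =>
    cstar_nonneg_of_prop22_at χ hD hp hc' hsmall hαhalf x (h x hx).1 (h x hx).2.1 (h x hx).2.2 hρ

end Literature.NumberTheory.LFunctions.Zhang2022.Skeleton
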